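import Mathlib
import HarnessLib
import HarnessLib.Audit
import Summits.QuantumFields.Statement
import Summits.QuantumFields.YangMills.Theorems.WeakCouplingRates
import Literature.MathematicalPhysics.QuantumLattice.GaugeGroups
import HarnessLib.Audit.Status.Attr

/-!
Route: BootstrapRigidity

CLOSED (superseded) 2026-08-27T21:36:08Z by planner-ym-idea-1-g0-0 — reason: superseded:route-QuantumFields-XiPowWidening — superseded by route-QuantumFields-XiPowWidening — note: leaf XiPowSU2 already proved in tree (xiPowSU2_holds); idea-crit-4 STRIKE 20:39:16Z on the target only (mechanism not struck); the same cruxes re-typed G-generically live in route-QuantumFields-XiPowWidening (critic PASS-WITH-PRICE 20:58:06Z), closes_target R2xi-G. The file is kept as the record of this route; refuted decls are indexed as negative knowledge (`ledger negatives`).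

# Route BootstrapRigidity — SU(2)4 gap <= beta^(-eps) from state-space rigidity of the plaquette
correlator plus one witness state

RUNG LINE (D-0145 ideator seat ym-idea-1, technique card «restrict-then-tighten»; bears_on LADDER-YM
rung R2ξ; it closes the
registered leaf `Summit.QuantumFields.YangMills.Theorems.WeakCouplingRates.XiPowSU2` — NOT the
summit `YangMills`, and no summit is
proved by this line). It suffices to show X = RIGIDITY ∧ WITNESS, two statements about the convex
set 𝒢_inv(β) of
translation-invariant DLR states of SU(2) Wilson theory on ℤ⁴ (no volume parameter anywhere):
(RIGIDITY, the widening step) any two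
states of 𝒢_inv(β) have the same connected (1,2)-plaquette time correlator `rpCorr μ (plaqCost0 ρ 1
2) n` at every separation
n ≤ 2β^A up to C·n^q·β^(−a) with a > 2; (WITNESS, the restricted class) for every large β and every
such n SOME state of 𝒢_inv(β)
has the free-gluon-size floor κ·β^(−2)·n^(−p) under that correlator. Torus limit points are in
𝒢_inv(β) (support), so every limit
point inherits the floor κ/2·β^(−2)·n^(−p) at n = ⌈β^A'⌉ (support, arithmetic), and the tree kernel
(RP spectral floor
`HasRPTimeGap.le_log_div`, then log β/β^A ≤ β^(−A/2)) gives `XiPowSU2` with ε = A'/2 (support). Card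
realised:
bootstrap-rigidity-witness-xipow.
Lean: `(∃ A C β₀ a : ℝ, ∃ q : ℕ, 0 < A ∧ 2 < a ∧ ∀ β : ℝ, β₀ ≤ β → ∀ μ ν : MeasureTheory.Measure
(Literature.MathematicalPhysics.QuantumLattice.LGConfig 4 (Matrix.specialUnitaryGroup (Fin 2) ℂ)), μ
∈ Literature.MathematicalPhysics.QuantumLattice.ymGibbsMeasures (d := 4)
(Literature.MathematicalPhysics.QuantumLattice.fundamentalRep (Fin 2)) β → ν ∈
Literature.MathematicalPhysics.QuantumLattice.ymGibbsMeasures (d := 4)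
(Literature.MathematicalPhysics.QuantumLattice.fundamentalRep (Fin 2)) β →
MeasureTheory.IsProbabilityMeasure μ → MeasureTheory.IsProbabilityMeasure ν →
Literature.MathematicalPhysics.QuantumLattice.IsZdTranslationInvariant μ →
Literature.MathematicalPhysics.QuantumLattice.IsZdTranslationInvariant ν → ∀ n : ℕ, 1 ≤ n → (n : ℝ)
≤ 2 * β ^ A → |Summit.QuantumFields.YangMills.Theorems.WeakCouplingRates.rpCorr μ
(Summit.QuantumFields.YangMills.Theorems.WeakCouplingRates.plaqCost0
(Literature.MathematicalPhysics.QuantumLattice.fundamentalRep (Fin 2)) (1 : Fin 4) 2) n -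
Summit.QuantumFields.YangMills.Theorems.WeakCouplingRates.rpCorr ν
(Summit.QuantumFields.YangMills.Theorems.WeakCouplingRates.plaqCost0
(Literature.MathematicalPhysics.QuantumLattice.fundamentalRep (Fin 2)) (1 : Fin 4) 2) n| ≤ C * (n :
ℝ) ^ q * β ^ (-a)) ∧ (∃ A κ β₀ : ℝ, ∃ p : ℕ, 0 < A ∧ 0 < κ ∧ ∀ β : ℝ, β₀ ≤ β → ∀ n : ℕ, 1 ≤ n → (n :
ℝ) ≤ 2 * β ^ A → ∃ ν : MeasureTheory.Measure (Literature.MathematicalPhysics.QuantumLattice.LGConfig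
4 (Matrix.specialUnitaryGroup (Fin 2) ℂ)), ν ∈
Literature.MathematicalPhysics.QuantumLattice.ymGibbsMeasures (d := 4)
(Literature.MathematicalPhysics.QuantumLattice.fundamentalRep (Fin 2)) β ∧
MeasureTheory.IsProbabilityMeasure ν ∧
Literature.MathematicalPhysics.QuantumLattice.IsZdTranslationInvariant ν ∧ κ * β ^ (-(2 : ℝ)) / (n :
ℝ) ^ p ≤ Summit.QuantumFields.YangMills.Theorems.WeakCouplingRates.rpCorr ν
(Summit.QuantumFields.YangMills.Theorems.WeakCouplingRates.plaqCost0
(Literature.MathematicalPhysics.QuantumLattice.fundamentalRep (Fin 2)) (1 : Fin 4) 2) n)`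

## Assembly
Pure composition (glue.lean, `lean check` rc 0): `closes hR hW hL hF hX := hX (hF hR hW hL)` — the
two cruxes and the limit-point support
feed the arithmetic support, whose conclusion is the hypothesis of the kernel support, whose
conclusion is the leaf `XiPowSU2`. All five
items are binders of `closes` and consumed by its proof term (BC6: declared 5 / in-cone 5 / aside 0;
no separate target or assembly item — X is the conjunction of the two cruxes).

CLOSES_TARGET: closes rung R2xi of QuantumFields: Summit.QuantumFields.YangMills.Theorems.WeakCouplingRates.XiPowSU2 (D-0061; not the summit Statement) — the deciding theorem of this route concludes that registered leaf instead of the Statement decl `YangMills` (class rung: servable and labelled, never counted as concluding the summit Statement).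

Rationale: WHY THIS LINE. Two listed routes want the same perturbative window for EVERY limit point and leave
it as their open crux: WeakCouplingRates reaches
the leaf through finite volumes, BOX (a cold-wall box two-point floor by cluster expansion) ∧ BULK
(torus-versus-box domination, a
two-state comparison inside a growing torus) ∧ FLOOR; XiCompleteMonotonicity (items PolynomialWindow
stmt-QuantumFields-8937 /
FixedDistanceLower 8938: the floor A/(β² n⁸) for every limit point, all compact G) names the window
itself as the crux, tools
«chessboard/RP large-field bounds + Markov property». This line is a DECOMPOSITION of that window
(SU(2) case) by a new lever and never
compares volumes: it moves the problem to the STATE SPACE 𝒢_inv(β) ⊂ measures on ℤ⁴ configurations,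
where the loop (Schwinger–Dyson /
Makeenko–Migdal) equations hold exactly (tree: `isHaarShiftState_of_mem_ymGibbsMeasures`,
`loopEquation_su_two_loops_of_dispBound`)
and every Gram / square / reflection positivity is available, and asks for RIGIDITY — near-agreement
of all states on one local
correlator to order β^(−a), a > 2 — the infinite-volume, β-asymptotic form of what the lattice
bootstrap measures numerically (two-sided
SDP windows from loop equations + positivity: Anderson–Kruczenski arXiv:1612.08140; Kazakov–Zheng
arXiv:2203.11360 p.3 «the upper bound
data in the weak coupling phase reproduce well the 3-loop PT», arXiv:2404.16925 (SU(2), D=4);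
Guo–Li–Yang–Zheng arXiv:2502.14421).
Imported area: convex duality / sums-of-squares certificates over the state space (a certificate
valid for every positive normalised
solution of the truncated loop equations is valid for every DLR state, uniformly in anything the
state depends on). Restrict-then-tighten:
WITNESS proves the floor for ONE constructible invariant state per (β, n) (e.g. the Cesàro average
of a cold-boundary DLR limit, where
covariance is concave under averaging), RIGIDITY widens it to all of 𝒢_inv(β), in particular to
every torus limit point of either parity
— the kernel's `infiniteVolumeLimitPoints` range over all subsequences, where link-RP/chessboard
tools are unavailable; rigidity does not
need them. Nothing in the negatives index (7 entries) concerns 𝒢_inv(β) correlators; the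
HyperbolicToTorusR negative lemma
(`transInv_unique_of_extremal`: «all invariant states extremal» = uniqueness) is respected —
RIGIDITY is a quantitative window on ONE
correlator, not purity or uniqueness of the phase.

RANKED CRUXES. #2 CorrelatorRigidity (crux) — RIGIDITY — there are A > 0, a > 2, C, q, β₀ such that
for β ≥ β₀ any two translation-invariant DLR probability states μ, ν of SU(2)₄ Wilson theory
(fundamental representation, tree coupling β) satisfy |rpCorr μ F n − rpCorr ν F n| ≤ C n^q β^(−a)
for all 1 ≤ n ≤ 2β^A, F = plaqCost0 ρ 1 2 (card item K1; the widening step). [difficulty: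
open-problem] (why it might fail: two coexisting invariant phases at large β whose plaquette means
differ at order β^(−a/2) (mixtures then break the window: Cov of a mixture adds ¼(Δmean)²), or
certificates whose level must grow faster than poly(β): KZ's LOWER plaquette bound is loose at weak
coupling at L_max = 16.) [arXiv:2203.11360, arXiv:2404.16925, arXiv:1612.08140, arXiv:2502.14421]
#3 WitnessStateFloor (crux) — WITNESS — there are A, κ > 0, p, β₀ such that for β ≥ β₀ and every 1 ≤
n ≤ 2β^A some translation-invariant DLR probability state ν has κ β^(−2) n^(−p) ≤ rpCorr ν
(plaqCost0 ρ 1 2) n (card item K2; the restricted class = one constructible state per (β, n)).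
[difficulty: XL] (why it might fail: free-gluon (β^(−2) n^(−8)) control of a connected correlator at
n ≤ 2β^A must survive the infinite-volume limit of the one state we can build (no feedback from
large-scale disorder): a poly(β)-scale small-field analysis with arbitrary small-field boundary
data, not in print.) [arXiv:1803.01950, Balaban1985AveragingYM, arXiv:2505.16585,
OsterwalderSeiler1978]
#9 LimitPointsAreInvariantDLR (support) — every infinite-volume torus limit point (any subsequence
of sides L_k + 1) of SU(2)₄ Wilson theory is a DLR state for `ymSpecification` and is ℤ⁴-translation
invariant (Georgii Thm 4.17 / Seiler Ch. 2; tree: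
`isHaarShiftState_of_mem_infiniteVolumeLimitPoints`,
`classBInvariances_of_mem_infiniteVolumeLimitPoints`, fact
`mem_ymGibbsMeasures_of_mem_infiniteVolumeLimitPoints`). [difficulty: M] [Georgii2011,
arXiv:1803.01950, SeilerLNP1982]
#9 FloorOfRigidityAndWitness (support) — arithmetic glue — RIGIDITY (A, C, q, a) + WITNESS (A′, κ,
p) + limit points ∈ 𝒢_inv(β) ⇒ every limit point has the floor (κ/2) β^(−2) n^(−p) at all 1 ≤ n ≤
2β^(A″) with A″ = min(A, A′, (a−2)/(2(p+q+1))) (choose β large so that C n^q β^(−a) ≤ ½ κ β^(−2)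
n^(−p) on that range). [difficulty: M] [arXiv:1803.01950]
#9 XiPowOfLimitPointFloor (support) — kernel transfer in WCR currency — a floor κ β^(−2) n^(−p) at
all separations 1 ≤ n ≤ 2β^A for every limit point ⇒ `XiPowSU2` with ε = A/2: apply
`HasRPTimeGap.le_log_div` with F = plaqCost0 ρ 1 2 (`plaqCost0_support`,
`continuous_bounded_plaqCost0`, `continuous_fundamentalRep`), t = ⌈β^A⌉, δ = κ β^(−2) t^(−p), V = C²
+ 1, then log(V t^p β²/κ)/⌈β^A⌉ ≤ β^(−A/2) eventually (the calc of
`massGapPowerDecayOf_of_powerLawCorr`). [difficulty: M] [arXiv:1803.01950]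

TWO-LAYER PLAN. CorrelatorRigidity ⇐ LoopValueRigidity (all states agree on every single Wilson loop
of extent ≤ 2β^A to O(|w|^q β^(−a)); linear
functionals, the natural SDP/SOS certificate target) → MandelstamTransfer (SU(2): tr A·tr B = tr AB
+ tr AB⁻¹, tree
`trace_mul_trace_su_two`, turns the connected plaquette correlator into single loops) →
CorrelatorRigidity. WitnessStateFloor ⇐
ColdStateFloor (the Cesàro-averaged cold-boundary DLR limit has the floor; concavity of covariance
under averaging) → its DLR /
invariance bookkeeping. First rung (BC5, plan-only): FixedSeparationRigidity — CorrelatorRigidity at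
ONE separation n = 1 with a = 3
(a β-uniform certificate family of fixed level), the statement the I4 engine can calibrate now.

KILL CRITERIA. Refutation of CorrelatorRigidity (two invariant DLR states at arbitrarily large β
whose separation-1 connected plaquette correlators
differ at order β^(−2)) closes the route (`refuted:CorrelatorRigidity`); a proof that
WitnessStateFloor needs volume-uniform cluster
control equivalent to WCR's BULK forces a pivot to the pseudo-state form (rigidity over positive
solutions of the loop equations, where
the witness is the perturbative series itself); XiPowSU2 proved via WeakCouplingRates, or
PolynomialWindow (stmt-QuantumFields-8937) proved directly, moots the line (shared leaf / implied
floor).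

NOT DECOMPOSED YET. The certificate level Λ(β, n) and its growth; which positivity families (Gram,
square, site/link RP — the latter only for RP states)
the rigidity proof needs; the construction of the witness state (cold-boundary limit + Cesàro
averaging vs. torus limit along even
sides with chessboard bounds); constants a, q, p (physically a ≥ 3, p = 8).

CHEAPEST FALSIFIER. Run the I4 lattice-bootstrap engine (pub-gaugeboot: SU(2), D = 4, loop equations
`loopEquation_su_two_loops_of_dispBound` + Gram +
site/link RP blocks) at tree couplings β ∈ (4, 8, 16) with L_max ∈ (8, 12, 16) on TWO objectives:
the plaquette window width w(β, Λ)
and the window of the separation-1 connected correlator ½(u(P·t·P·t⁻¹) + u(P·t·P⁻¹·t⁻¹)) − u_P·ū_P.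
The line dies if w(β, Λ) does
not shrink faster than β^(−1) as Λ grows at fixed large β (RIGIDITY needs window o(β^(−1)) on means
and o(β^(−2)) on the connected
correlator); it is calibrated if β²·(lower window edge of the connected correlator) stabilises near
the free-gluon value. Printed
evidence so far is one-sided: KZ's upper bound hugs 3-loop PT at L_max = 16, the lower bound does
not (arXiv:2203.11360 p.3, Fig. 2).
Not run here (SDP of that size exceeds the seat's 4 cores; it is the instrument row I4's standing
engine).

NUMBERS. Free two-gluon exchange: β²·Cov(c_0, c_n) ≍ n^(−8) at separation n (WCR Currency docstring
of `PolySeparationPlaquetteFloor`); KZ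
SU(∞) D=4: L_max = 16 upper bound within plotting accuracy of 3-loop PT for λ below the transition
λ_c ≈ 1.4 (arXiv:2203.11360 p.3);
I4 census: 433 exact-rational SDP certificates, e.g. SU(2) D=4 β_std = 1: ū_P ∈ [0.2221, 0.6333]
(LADDER-YM row I4).

DEFINITION REQUESTS. None: all items are typed over tree declarations (`ymGibbsMeasures`,
`IsZdTranslationInvariant`, `infiniteVolumeLimitPoints`,
`rpCorr`, `plaqCost0`, `XiPowSU2`).

Novelty: Searches (2026-08-27): lit search --hybrid "lattice Yang-Mills bootstrap loop equations positivity
semidefinite bounds plaquette" (8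
docs: Montvay–Münster, Creutz, Greensite, Rivasseau, Gambini–Pullin …, no rigidity statement); lit
search "Kazakov Zheng bootstrap
lattice" (6 local: arXiv:2203.11360, 2404.16925, 2502.14421, 2507.02386, 2309.04472, 2505.16585;
remote 6); lit vsearch "all
translation invariant Gibbs states of 4d lattice gauge theory at weak coupling have the same
plaquette expectation…" (8 books, none on
point); lit galaxy search "lattice bootstrap|loop equation bootstrap|Migdal-Makeenko" --star all (9
rows, noise) and "uniqueness of
the Gibbs state|translation invariant Gibbs states|weak coupling expansion" --star pdf (8 rows,
noise); ledger negatives --problem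
QuantumFields (7, none related); tree: Theses/WeakCouplingRates.lean, GaugeBoot/ClassB*.lean,
HyperbolicToTorusR/Negative.
Nearest prior art found: arXiv:2203.11360 / arXiv:2404.16925 (Kazakov–Zheng: numerical two-sided SDP
bounds on u_P at fixed coupling,
fixed L_max; no β-asymptotic or all-states statement), arXiv:1612.08140 (Anderson–Kruczenski: loop
equations + Gram positivity),
route WeakCouplingRates (same leaf via BOX ∧ BULK in finite volumes), route XiCompleteMonotonicity
(PolynomialWindow /
FixedDistanceLower: the limit-point floor itself as crux, general G), GaugeBoot cell (tree; fixed-β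
certificates, explicitly not
summit-bearing).
Delta: decomposes the limit-point window (XiCompleteMonotonici  [refs: 2203.11360, 2404.16925, 1612.08140]

Barriers (technique_class: bootstrap-positivity, loop-equations, dlr-state-space): - technique_class: bootstrap-positivity, loop-equations, dlr-state-space
- Literature.Barriers.QuantumFields.FixedCouplingUltralocality: outside — the barrier kills fixed-β
/ bounded-ξ statements as summit evidence; this line's statements are β → ∞ asymptotics (ξ ≥ β^ε)
and claim no continuum limit; the certificates must be β-uniform families, which is exactly crux
CorrelatorRigidity.
- Literature.Barriers.QuantumFields.PerturbativeInvisibility: outside — the barrier says the gap (a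
LOWER bound on m, scale e^(−cβ)) is invisible to any finite order in g; the leaf is an UPPER bound
on m whose content is precisely that correlations of perturbative size β^(−2) n^(−8) persist, so
perturbative visibility is the resource, not the obstacle.
- Literature.Barriers.QuantumFields.UVStabilityNonUniqueness: it does, partly — stability bounds
give existence not uniqueness, and RIGIDITY is a near-uniqueness window; the bet is that positivity
+ exact loop equations (an over-determined linear system on loop values), not stability bounds, pin
ONE local correlator to O(β^(−a)) without pinning the state.
- Literature.Barriers.QuantumFields.RegularisationDichotomy: not applicable — one lattice
regularisation, no Euclidean invariance or continuum limit is claimed.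
- Negatives index: 7 refuted statements (CurvatureAnchor, SelfNormalisedSkewness, RobustYangMillsRG,
DiagonalMirrorRP, AdaptiveCoarseSystem, MultibosonLatticeGap, AdmissibleRootsExist) — none
quantifies over 𝒢_inv(β) or `rpCorr`; the line

History (route lifecycle, newest last):
- 2026-08-27T21:36:08Z · CLOSED superseded — superseded:route-QuantumFields-XiPowWidening (planner-ym-idea-1-g0-0)

sub-problem: YangMills · status: closed(superseded) · opened planner-ym-idea-1-g0-0 2026-08-27T20:30:32Z · rev 0 · ledger route-QuantumFields-BootstrapRigidity
GENERATED by the gate from the ledger (D-0016/17). Provers cite these decls: `theorem foo : Summit.QuantumFields.YangMills.Theses.BootstrapRigidity.<Decl> := …` in Summits/QuantumFields/YangMills/Theorems/<Name>.lean.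
-/

namespace Summit.QuantumFields.YangMills.Theses.BootstrapRigidity

open scoped BigOperators Topology Manifold Classical MeasureTheory ProbabilityTheory Matrix InnerProductSpace ComplexConjugate ContinuousMap
open Filter Set Function TopologicalSpace MeasureTheory

attribute [summit_statement] _root_.YangMills
attribute [summit_statement] _root_.Summit.QuantumFields.YangMills.Theorems.WeakCouplingRates.XiPowSU2

/-- item stmt-QuantumFields-21986 · crux · rank 2 · closed · moot by None · by planner
why it might fail: two coexisting invariant phases at large β whose plaquette means differ at order β^(−a/2) (mixtures then break the window: Cov of a mixture adds ¼(Δmean)²), or certificates whose level must grow faster than poly(β): KZ's LOWER plaquette bound is loose at weak coupling at L_max = 16.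
sources: arXiv:2203.11360, arXiv:2404.16925, arXiv:1612.08140, arXiv:2502.14421
[crux] RIGIDITY — there are A > 0, a > 2, C, q, β₀ such that for β ≥ β₀ any two
translation-invariant DLR probability states μ, ν of SU(2)₄ Wilson theory (fundamental
representation, tree coupling β) satisfy |rpCorr μ F n − rpCorr ν F n| ≤ C n^q β^(−a) for all 1 ≤ n
≤ 2β^A, F = plaqCost0 ρ 1 2 (card item K1; the widening step). [difficulty: open-problem] -/
@[route_item "route-QuantumFields-BootstrapRigidity", crux]
def CorrelatorRigidity : Prop :=
  ∃ A C β₀ a : ℝ, ∃ q : ℕ, 0 < A ∧ 2 < a ∧ ∀ β : ℝ, β₀ ≤ β → ∀ μ ν : MeasureTheory.Measure (Literature.MathematicalPhysics.QuantumLattice.LGConfig 4 (Matrix.specialUnitaryGroup (Fin 2) ℂ)), μ ∈ Literature.MathematicalPhysics.QuantumLattice.ymGibbsMeasures (d := 4) (Literature.MathematicalPhysics.QuantumLattice.fundamentalRep (Fin 2)) β → ν ∈ Literature.MathematicalPhysics.QuantumLattice.ymGibbsMeasures (d := 4) (Literature.MathematicalPhysics.QuantumLattice.fundamentalRep (Fin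 2)) β → MeasureTheory.IsProbabilityMeasure μ → MeasureTheory.IsProbabilityMeasure ν → Literature.MathematicalPhysics.QuantumLattice.IsZdTranslationInvariant μ → Literature.MathematicalPhysics.QuantumLattice.IsZdTranslationInvariant ν → ∀ n : ℕ, 1 ≤ n → (n : ℝ) ≤ 2 * β ^ A → |Summit.QuantumFields.YangMills.Theorems.WeakCouplingRates.rpCorr μ (Summit.QuantumFields.YangMills.Theorems.WeakCouplingRates.plaqCost0 (Literature.MathematicalPhysics.QuantumLattice.fundamentalRep (Fin 2)) (1 : Fin 4) 2) n - Summit.QuantumFields.YangMills.Theorems.WeakCouplingRates.rpCorr ν (Summit.QuantumFields.YangMills.Theorems.WeakCouplingRates.plaqCost0 (Literature.MathematicalPhysics.QuantumLattice.fundamentalRep (Fin 2)) (1 : Fin 4) 2) n| ≤ C * (n : ℝ) ^ q * β ^ (-a)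

/-- item stmt-QuantumFields-21987 · crux · rank 3 · closed · moot by None · by planner
why it might fail: free-gluon (β^(−2) n^(−8)) control of a connected correlator at n ≤ 2β^A must survive the infinite-volume limit of the one state we can build (no feedback from large-scale disorder): a poly(β)-scale small-field analysis with arbitrary small-field boundary data, not in print.
sources: arXiv:1803.01950, Balaban1985AveragingYM, arXiv:2505.16585, OsterwalderSeiler1978
[crux] WITNESS — there are A, κ > 0, p, β₀ such that for β ≥ β₀ and every 1 ≤ n ≤ 2β^A some
translation-invariant DLR probability state ν has κ β^(−2) n^(−p) ≤ rpCorr ν (plaqCost0 ρ 1 2) n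
(card item K2; the restricted class = one constructible state per (β, n)). [difficulty: XL] -/
@[route_item "route-QuantumFields-BootstrapRigidity", crux]
def WitnessStateFloor : Prop :=
  ∃ A κ β₀ : ℝ, ∃ p : ℕ, 0 < A ∧ 0 < κ ∧ ∀ β : ℝ, β₀ ≤ β → ∀ n : ℕ, 1 ≤ n → (n : ℝ) ≤ 2 * β ^ A → ∃ ν : MeasureTheory.Measure (Literature.MathematicalPhysics.QuantumLattice.LGConfig 4 (Matrix.specialUnitaryGroup (Fin 2) ℂ)), ν ∈ Literature.MathematicalPhysics.QuantumLattice.ymGibbsMeasures (d := 4) (Literature.MathematicalPhysics.QuantumLattice.fundamentalRep (Fin 2)) β ∧ MeasureTheory.IsProbabilityMeasure ν ∧ Literature.MathematicalPhysics.QuantumLattice.IsZdTranslationInvariant ν ∧ κ * β ^ (-(2 : ℝ)) / (n : ℝ) ^ p ≤ Summit.QuantumFields.YangMills.Theorems.WeakCouplingRates.rpCorr ν (Summit.QuantumFields.YangMills.Theorems.WeakCouplingRates.plaqCost0 (Literature.MathematicalPhysics.QuantumLattice.fundamentalRep (Fin 2)) (1 : Fin 4) 2) n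

/-- item stmt-QuantumFields-21988 · support · rank 9 · closed · moot by None · by planner
sources: Georgii2011, arXiv:1803.01950, SeilerLNP1982
[support] every infinite-volume torus limit point (any subsequence of sides L_k + 1) of SU(2)₄
Wilson theory is a DLR state for `ymSpecification` and is ℤ⁴-translation invariant (Georgii Thm 4.17
/ Seiler Ch. 2; tree: `isHaarShiftState_of_mem_infiniteVolumeLimitPoints`,
`classBInvariances_of_mem_infiniteVolumeLimitPoints`, fact
`mem_ymGibbsMeasures_of_mem_infiniteVolumeLimitPoints`). [difficulty: M] -/
@[route_item "route-QuantumFields-BootstrapRigidity", crux]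
def LimitPointsAreInvariantDLR : Prop :=
  ∀ β : ℝ, ∀ μ ∈ Literature.MathematicalPhysics.QuantumLattice.infiniteVolumeLimitPoints (d := 4) (Literature.MathematicalPhysics.QuantumLattice.fundamentalRep (Fin 2)) β, μ ∈ Literature.MathematicalPhysics.QuantumLattice.ymGibbsMeasures (d := 4) (Literature.MathematicalPhysics.QuantumLattice.fundamentalRep (Fin 2)) β ∧ Literature.MathematicalPhysics.QuantumLattice.IsZdTranslationInvariant μ

/-- item stmt-QuantumFields-21989 · support · rank 9 · closed · moot by None · by planner
sources: arXiv:1803.01950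
[support] arithmetic glue — RIGIDITY (A, C, q, a) + WITNESS (A′, κ, p) + limit points ∈ 𝒢_inv(β) ⇒
every limit point has the floor (κ/2) β^(−2) n^(−p) at all 1 ≤ n ≤ 2β^(A″) with A″ = min(A, A′,
(a−2)/(2(p+q+1))) (choose β large so that C n^q β^(−a) ≤ ½ κ β^(−2) n^(−p) on that range).
[difficulty: M] -/
@[route_item "route-QuantumFields-BootstrapRigidity", crux]
def FloorOfRigidityAndWitness : Prop :=
  (∃ A C β₀ a : ℝ, ∃ q : ℕ, 0 < A ∧ 2 < a ∧ ∀ β : ℝ, β₀ ≤ β → ∀ μ ν : MeasureTheory.Measure (Literature.MathematicalPhysics.QuantumLattice.LGConfig 4 (Matrix.specialUnitaryGroup (Fin 2) ℂ)), μ ∈ Literature.MathematicalPhysics.QuantumLattice.ymGibbsMeasures (d := 4) (Literature.MathematicalPhysics.QuantumLattice.fundamentalRep (Fin 2)) β → ν ∈ Literature.MathematicalPhysics.QuantumLattice.ymGibbsMeasures (d := 4) (Literature.MathematicalPhysics.QuantumLattice.fundamentalRep (Fin 2)) β → MeasureTheory.IsProbabilityMeasure μ → MeasureTheory.IsProbabilityMeasure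 ν → Literature.MathematicalPhysics.QuantumLattice.IsZdTranslationInvariant μ → Literature.MathematicalPhysics.QuantumLattice.IsZdTranslationInvariant ν → ∀ n : ℕ, 1 ≤ n → (n : ℝ) ≤ 2 * β ^ A → |Summit.QuantumFields.YangMills.Theorems.WeakCouplingRates.rpCorr μ (Summit.QuantumFields.YangMills.Theorems.WeakCouplingRates.plaqCost0 (Literature.MathematicalPhysics.QuantumLattice.fundamentalRep (Fin 2)) (1 : Fin 4) 2) n - Summit.QuantumFields.YangMills.Theorems.WeakCouplingRates.rpCorr ν (Summit.QuantumFields.YangMills.Theorems.WeakCouplingRates.plaqCost0 (Literature.MathematicalPhysics.QuantumLattice.fundamentalRep (Fin 2)) (1 : Fin 4) 2) n| ≤ C * (n : ℝ) ^ q * β ^ (-a)) → (∃ A κ β₀ : ℝ, ∃ p : ℕ, 0 < A ∧ 0 < κ ∧ ∀ β : ℝ, β₀ ≤ β → ∀ n : ℕ, 1 ≤ n → (n : ℝ) ≤ 2 * β ^ A → ∃ ν : MeasureTheory.Measure (Literature.MathematicalPhysics.QuantumLattice.LGConfig 4 (Matrix.specialUnitaryGroup (Fin 2) ℂ)), ν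 ∈ Literature.MathematicalPhysics.QuantumLattice.ymGibbsMeasures (d := 4) (Literature.MathematicalPhysics.QuantumLattice.fundamentalRep (Fin 2)) β ∧ MeasureTheory.IsProbabilityMeasure ν ∧ Literature.MathematicalPhysics.QuantumLattice.IsZdTranslationInvariant ν ∧ κ * β ^ (-(2 : ℝ)) / (n : ℝ) ^ p ≤ Summit.QuantumFields.YangMills.Theorems.WeakCouplingRates.rpCorr ν (Summit.QuantumFields.YangMills.Theorems.WeakCouplingRates.plaqCost0 (Literature.MathematicalPhysics.QuantumLattice.fundamentalRep (Fin 2)) (1 : Fin 4) 2) n) → (∀ β : ℝ, ∀ μ ∈ Literature.MathematicalPhysics.QuantumLattice.infiniteVolumeLimitPoints (d := 4) (Literature.MathematicalPhysics.QuantumLattice.fundamentalRep (Fin 2)) β, μ ∈ Literature.MathematicalPhysics.QuantumLattice.ymGibbsMeasures (d := 4) (Literature.MathematicalPhysics.QuantumLattice.fundamentalRep (Fin 2)) β ∧ Literature.MathematicalPhysics.QuantumLattice.IsZdTranslationInvariant μ) → ∃ A κ β₀ : ℝ, ∃ p : ℕ, 0 < A ∧ 0 < κ ∧ ∀ β : ℝ,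 β₀ ≤ β → ∀ μ ∈ Literature.MathematicalPhysics.QuantumLattice.infiniteVolumeLimitPoints (d := 4) (Literature.MathematicalPhysics.QuantumLattice.fundamentalRep (Fin 2)) β, ∀ n : ℕ, 1 ≤ n → (n : ℝ) ≤ 2 * β ^ A → κ * β ^ (-(2 : ℝ)) / (n : ℝ) ^ p ≤ Summit.QuantumFields.YangMills.Theorems.WeakCouplingRates.rpCorr μ (Summit.QuantumFields.YangMills.Theorems.WeakCouplingRates.plaqCost0 (Literature.MathematicalPhysics.QuantumLattice.fundamentalRep (Fin 2)) (1 : Fin 4) 2) n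

/-- item stmt-QuantumFields-21990 · support · rank 9 · closed · moot by None · by planner
sources: arXiv:1803.01950
[support] kernel transfer in WCR currency — a floor κ β^(−2) n^(−p) at all separations 1 ≤ n ≤ 2β^A
for every limit point ⇒ `XiPowSU2` with ε = A/2: apply `HasRPTimeGap.le_log_div` with F = plaqCost0
ρ 1 2 (`plaqCost0_support`, `continuous_bounded_plaqCost0`, `continuous_fundamentalRep`), t = ⌈β^A⌉,
δ = κ β^(−2) t^(−p), V = C² + 1, then log(V t^p β²/κ)/⌈β^A⌉ ≤ β^(−A/2) eventually (the calc of
`massGapPowerDecayOf_of_powerLawCorr`). [difficulty: M] -/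
@[route_item "route-QuantumFields-BootstrapRigidity", crux]
def XiPowOfLimitPointFloor : Prop :=
  (∃ A κ β₀ : ℝ, ∃ p : ℕ, 0 < A ∧ 0 < κ ∧ ∀ β : ℝ, β₀ ≤ β → ∀ μ ∈ Literature.MathematicalPhysics.QuantumLattice.infiniteVolumeLimitPoints (d := 4) (Literature.MathematicalPhysics.QuantumLattice.fundamentalRep (Fin 2)) β, ∀ n : ℕ, 1 ≤ n → (n : ℝ) ≤ 2 * β ^ A → κ * β ^ (-(2 : ℝ)) / (n : ℝ) ^ p ≤ Summit.QuantumFields.YangMills.Theorems.WeakCouplingRates.rpCorr μ (Summit.QuantumFields.YangMills.Theorems.WeakCouplingRates.plaqCost0 (Literature.MathematicalPhysics.QuantumLattice.fundamentalRep (Fin 2)) (1 : Fin 4) 2) n) → Summit.QuantumFields.YangMills.Theorems.WeakCouplingRates.XiPowSU2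

/-- item stmt-QuantumFields-21991 · assembly · rank 1 · closed · moot by None · by planner
sources: arXiv:1803.01950
[assembly] CorrelatorRigidity → WitnessStateFloor → LimitPointsAreInvariantDLR →
FloorOfRigidityAndWitness → XiPowOfLimitPointFloor → XiPowSU2 (the rung leaf, `closes_target:
R2xi`). -/
@[route_item "route-QuantumFields-BootstrapRigidity"]
def Assembly : Prop :=
  CorrelatorRigidity → WitnessStateFloor → LimitPointsAreInvariantDLR → FloorOfRigidityAndWitness → XiPowOfLimitPointFloor → Summit.QuantumFields.YangMills.Theorems.WeakCouplingRates.XiPowSU2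

/-! D-0027 §2.1 — DECIDING THEOREM (planner-authored via `route open/edit --closes-file`; by planner-ym-idea-1-g0-0 2026-08-27T20:30:32Z) — ARCHIVED: route closed (superseded) 2026-08-27T21:36:08Z; kept so importers keep building:
its hypotheses are this route's items and its conclusion the registered leaf `Summit.QuantumFields.YangMills.Theorems.WeakCouplingRates.XiPowSU2` (rung R2xi, D-0061) (glue_lint), and it elaborates with this file. -/

@[closes "route-QuantumFields-BootstrapRigidity"] theorem closes (hR : CorrelatorRigidity) (hW : WitnessStateFloor) (hL : LimitPointsAreInvariantDLR)
    (hF : FloorOfRigidityAndWitness) (hX : XiPowOfLimitPointFloor) :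
    Summit.QuantumFields.YangMills.Theorems.WeakCouplingRates.XiPowSU2 :=
  hX (hF hR hW hL)

end Summit.QuantumFields.YangMills.Theses.BootstrapRigidity
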